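import Mathlib
import Literature.Computability.Complexity.CliqueTestGraphs

/-!
# PneNP / ConvexRankGates — `ConvexGateBlind`: ε-free (strict-rank) forms of the canonical matrix statements

Helpers (`--supports stmt-PneNP-10680`). The canonical forms of the crux proved so far
(`convexGateBlind_iff_cliqueDistConeRankHard` in `…CanonicalForm.lean`, LP slice `cliqueDist_rankHard_iff_lpDataHard` in
`…CliqueDistanceConverse.lean`) quantify over an arbitrarily small shift `ε > 0` of the one-sided clique-distance matrix
`D[Q,u] = #(E(Q) ∖ u)` (`Q` the `k`-sets, `u` the `k`-clique-free graphs of `K_m`, `k = ⌈m^δ⌉₊`). Following Hrubeš's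
*strict rank* (`rk₊₊`; Lemma 16 / Proposition 17 of `Hrubes2020`), the limit `ε → 0` can be traded for ONE existential
object, with no loss beyond the `∀ c` slack. This file proves the two matrix-level equivalences (no circuits, no route
declarations — only `cliqueFn` / `cliqueVec`):

* `cliqueDistConeRankHard_iff_strictConeRankHard` — full cone: "∀ c, eventually, ∀ ε > 0, no
  `(PSD_q ⊕ ℝ^r_{≥0})`-factorisation of `D - εJ` with `q + r ≤ m^c`" iff "∀ c, eventually, no factorisation
  `D[Q,u] = tr(H_u Y_Q) + ∑_l U_{u,l} V_{l,Q} + a_u b_Q` with `H_u, Y_Q ⪰ 0`, `U, V ≥ 0`, POSITIVE `a, b` and `q + r ≤ m^c`"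
  (`⇐`: `a = ε`, `b = 1`; `⇒`: `a ⊗ b - (min a)(min b) J = (min a) 1 ⊗ (b - min b) + (a - min a) ⊗ b` is an explicit
  two-term non-negative factorisation, so `ε := (min a)(min b)` works with `r + 2` terms).
* `cliqueDist_rankHard_iff_strictRankHard` — LP slice, in the form of Hrubeš's Open Problem 4 / Lemma 16 (iii): eventually
  there are no `r ≤ m^c` functions `g_l` STRICTLY POSITIVE on the `k`-sets and coefficients `λ_l(u) ≥ 0` with
  `D[Q,u] = ∑_l λ_l(u) g_l(Q)` (`rk₊₊(D) > m^c`); `⇐` shifts the generators by `θ = ε/(1 + ∑ U)` and adds the constant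
  generator, `⇒` peels `β = min g` and uses `D ≥ 1` (`one_le_cliqueDist`) to see that every row has positive total coefficient.
The corollaries for the crux itself (`convexGateBlind_iff_strictConeRankHard`, `lpDataHard_iff_strictRankHard`) are one-line
compositions with the canonical forms and live in `…StrictRank.lean`.
[folklore; Hrubeš 2020 (`Hrubes2020`, ECCC TR19-034), Lemma 16, Proposition 17, Theorem 20, Open Problems 3–4]
-/

namespace Summit.PneNP.PneNP.Theorems

open Matrix Finset Literature.Computability.Complexity

/-- Every `k`-set misses at least one edge of a `k`-clique-free graph: `D[Q,u] ≥ 1`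
(else `cliqueVec Q ≤ u` and `u` would contain the clique `Q`, by monotonicity of CLIQUE). [folklore] -/
theorem one_le_cliqueDist {m k : ℕ} {Q : Finset (Fin m)} (hQ : Q.card = k)
    {u : (⊤ : SimpleGraph (Fin m)).edgeSet → Bool} (hu : cliqueFn m k u = false) :
    (1 : ℝ) ≤ ∑ e, if cliqueVec Q e = true ∧ u e = false then (1 : ℝ) else 0 := by
  classical
  by_contra hlt
  rw [not_le] at hlt
  have hall : ∀ e, cliqueVec Q e = true → u e = true := by
    intro e he
    by_contra hue
    have hue' : u e = false := by simpa using hue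
    have h1 : (1 : ℝ) ≤ ∑ e', if cliqueVec Q e' = true ∧ u e' = false then (1 : ℝ) else 0 := by
      calc (1 : ℝ) = if cliqueVec Q e = true ∧ u e = false then (1 : ℝ) else 0 := by rw [if_pos ⟨he, hue'⟩]
        _ ≤ ∑ e', if cliqueVec Q e' = true ∧ u e' = false then (1 : ℝ) else 0 :=
          Finset.single_le_sum (f := fun e' => if cliqueVec Q e' = true ∧ u e' = false then (1 : ℝ) else 0)
            (fun e' _ => by split_ifs <;> norm_num) (Finset.mem_univ e)
    exact absurd h1 (not_le.mpr hlt)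
  have hle : cliqueVec Q ≤ u := fun e => by
    cases h : cliqueVec Q e
    · exact Bool.false_le _
    · rw [hall e h]
  have hmono := cliqueFn_monotone_holds m k hle
  rw [cliqueFn_cliqueVec hQ.ge, hu] at hmono
  exact absurd hmono (by decide)

/-- **ε-form ↔ strict form, full cone** (for a fixed `δ`). "For every `c`, eventually, for every `ε > 0`,
`D - εJ` has no `(PSD_q ⊕ ℝ^r_{≥0})`-factorisation with `q + r ≤ m^c`" iff "for every `c`, eventually,
`D` has no factorisation `tr(H_u Y_Q) + ∑_l U_{u,l} V_{l,Q} + a_u b_Q` with `H_u, Y_Q ⪰ 0` (`q × q`),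
`U, V ≥ 0` (`r` terms), `a, b > 0` and `q + r ≤ m^c`": Hrubeš's `min_ε rk₊(M - εJ) = rk₊₊(M) ± 1`
(Proposition 17) for the cone `PSD_q ⊕ ℝ^r_{≥0}`, the `± 1` absorbed by `∀ c`.
[folklore; Hrubeš 2020 (`Hrubes2020`), Lemma 16 (ii), Proposition 17] -/
theorem cliqueDistConeRankHard_iff_strictConeRankHard :
    ∀ δ : ℝ, (∀ c : ℕ, ∀ᶠ m : ℕ in Filter.atTop, ∀ ε : ℝ, 0 < ε → ∀ (q r : ℕ), q + r ≤ m ^ c →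
      ∀ (H : ((⊤ : SimpleGraph (Fin m)).edgeSet → Bool) → Matrix (Fin q) (Fin q) ℝ) (Y : Finset (Fin m) → Matrix (Fin q) (Fin q) ℝ)
        (U : ((⊤ : SimpleGraph (Fin m)).edgeSet → Bool) → Fin r → ℝ) (V : Fin r → Finset (Fin m) → ℝ),
        (∀ u, cliqueFn m ⌈(m : ℝ) ^ δ⌉₊ u = false → (H u).PosSemidef) →
        (∀ Q : Finset (Fin m), Q.card = ⌈(m : ℝ) ^ δ⌉₊ → (Y Q).PosSemidef) →
        (∀ u l, 0 ≤ U u l) → (∀ l Q, 0 ≤ V l Q) →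
        ¬ ∀ (Q : Finset (Fin m)) (u : (⊤ : SimpleGraph (Fin m)).edgeSet → Bool), Q.card = ⌈(m : ℝ) ^ δ⌉₊ → cliqueFn m ⌈(m : ℝ) ^ δ⌉₊ u = false →
            (∑ e, if cliqueVec Q e = true ∧ u e = false then (1 : ℝ) else 0) - ε =
              (H u * Y Q).trace + ∑ l, U u l * V l Q) ↔
    (∀ c : ℕ, ∀ᶠ m : ℕ in Filter.atTop, ∀ (q r : ℕ), q + r ≤ m ^ c →
      ∀ (H : ((⊤ : SimpleGraph (Fin m)).edgeSet → Bool) → Matrix (Fin q) (Fin q) ℝ) (Y : Finset (Fin m) → Matrix (Fin q) (Fin q) ℝ)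
        (U : ((⊤ : SimpleGraph (Fin m)).edgeSet → Bool) → Fin r → ℝ) (V : Fin r → Finset (Fin m) → ℝ)
        (a : ((⊤ : SimpleGraph (Fin m)).edgeSet → Bool) → ℝ) (b : Finset (Fin m) → ℝ),
        (∀ u, cliqueFn m ⌈(m : ℝ) ^ δ⌉₊ u = false → (H u).PosSemidef) →
        (∀ Q : Finset (Fin m), Q.card = ⌈(m : ℝ) ^ δ⌉₊ → (Y Q).PosSemidef) →
        (∀ u l, 0 ≤ U u l) → (∀ l Q, 0 ≤ V l Q) →
        (∀ u, cliqueFn m ⌈(m : ℝ) ^ δ⌉₊ u = false → 0 < a u) →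
        (∀ Q : Finset (Fin m), Q.card = ⌈(m : ℝ) ^ δ⌉₊ → 0 < b Q) →
        ¬ ∀ (Q : Finset (Fin m)) (u : (⊤ : SimpleGraph (Fin m)).edgeSet → Bool), Q.card = ⌈(m : ℝ) ^ δ⌉₊ → cliqueFn m ⌈(m : ℝ) ^ δ⌉₊ u = false →
            (∑ e, if cliqueVec Q e = true ∧ u e = false then (1 : ℝ) else 0) =
              (H u * Y Q).trace + ∑ l, U u l * V l Q + a u * b Q) := by
  classical
  intro δ
  constructor
  · -- a strict factorisation gives, with two more non-negative terms, a factorisation of `D - εJ`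
    intro hε c
    filter_upwards [hε (c + 1), Filter.eventually_ge_atTop 3] with m hm hm3
    intro q r hqr H Y U V a b hH hY hU hV ha hb hfact
    set k := ⌈(m : ℝ) ^ δ⌉₊ with hk
    set Su : Finset ((⊤ : SimpleGraph (Fin m)).edgeSet → Bool) := Finset.univ.filter fun u => cliqueFn m k u = false with hSu
    set SQ : Finset (Finset (Fin m)) := Finset.univ.filter fun Q => Q.card = k with hSQ
    have hbudget : q + (r + 2) ≤ m ^ (c + 1) := by
      have h1 : 1 ≤ m ^ c := Nat.one_le_pow _ _ (by omega)
      have : m ^ c * 3 ≤ m ^ (c + 1) := by rw [pow_succ]; exact Nat.mul_le_mul_left _ hm3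
      omega
    by_cases hne : Su.Nonempty ∧ SQ.Nonempty
    · obtain ⟨hSune, hSQne⟩ := hne
      set amin := Su.inf' hSune a with hamin
      set bmin := SQ.inf' hSQne b with hbmin
      have hamin_pos : 0 < amin := by
        rw [hamin, Finset.lt_inf'_iff]
        intro u hu
        exact ha u (Finset.mem_filter.1 hu).2
      have hbmin_pos : 0 < bmin := by
        rw [hbmin, Finset.lt_inf'_iff]
        intro Q hQ
        exact hb Q (Finset.mem_filter.1 hQ).2
      have hamin_le : ∀ u, cliqueFn m k u = false → amin ≤ a u := fun u hu => by
        have hmem : u ∈ Su := Finset.mem_filter.2 ⟨Finset.mem_univ _, hu⟩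
        exact Finset.inf'_le a hmem
      have hbmin_le : ∀ Q : Finset (Fin m), Q.card = k → bmin ≤ b Q := fun Q hQ => by
        have hmem : Q ∈ SQ := Finset.mem_filter.2 ⟨Finset.mem_univ _, hQ⟩
        exact Finset.inf'_le b hmem
      -- the two extra terms: `amin ⊗ (b - bmin)` and `(a - amin) ⊗ b`
      let U' : ((⊤ : SimpleGraph (Fin m)).edgeSet → Bool) → Fin (r + 2) → ℝ := fun u =>
        Fin.cons amin (Fin.cons (if cliqueFn m k u = false then a u - amin else 0) (U u))
      let V' : Fin (r + 2) → Finset (Fin m) → ℝ :=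
        Fin.cons (fun Q => if Q.card = k then b Q - bmin else 0)
          (Fin.cons (fun Q => if Q.card = k then b Q else 0) V)
      have hU' : ∀ u l, 0 ≤ U' u l := by
        intro u l
        refine Fin.cases ?_ (fun l => Fin.cases ?_ (fun l => ?_) l) l
        · exact hamin_pos.le
        · show 0 ≤ (if cliqueFn m k u = false then a u - amin else 0)
          split_ifs with hu
          · linarith [hamin_le u hu]
          · exact le_rfl
        · exact hU u l
      have hV' : ∀ l Q, 0 ≤ V' l Q := by
        intro l Q
        refine Fin.cases ?_ (fun l => Fin.cases ?_ (fun l => ?_) l) l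
        · show 0 ≤ (if Q.card = k then b Q - bmin else 0)
          split_ifs with hQ
          · linarith [hbmin_le Q hQ]
          · exact le_rfl
        · show 0 ≤ (if Q.card = k then b Q else 0)
          split_ifs with hQ
          · exact (hb Q hQ).le
          · exact le_rfl
        · exact hV l Q
      refine hm (amin * bmin) (mul_pos hamin_pos hbmin_pos) q (r + 2) hbudget H Y U' V' hH hY hU' hV' fun Q u hQ hu => ?_
      have hsum : ∑ l, U' u l * V' l Q =
          amin * (b Q - bmin) + ((a u - amin) * b Q + ∑ l, U u l * V l Q) := by
        rw [Fin.sum_univ_succ, Fin.sum_univ_succ]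
        simp only [U', V', Fin.cons_zero, Fin.cons_succ, if_pos hQ, if_pos hu]
      rw [hsum, hfact Q u hQ hu]
      ring
    · -- no clique-free graph or no `k`-set: both statements are vacuous
      refine hm 1 one_pos q r (by omega) H Y U V hH hY hU hV fun Q u hQ hu => ?_
      exact absurd ⟨⟨u, Finset.mem_filter.2 ⟨Finset.mem_univ _, hu⟩⟩, ⟨Q, Finset.mem_filter.2 ⟨Finset.mem_univ _, hQ⟩⟩⟩ hne
  · -- a factorisation of `D - εJ` is a strict factorisation with `a = ε`, `b = 1`
    intro hs c
    filter_upwards [hs c] with m hm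
    intro ε hε q r hqr H Y U V hH hY hU hV hfact
    exact hm q r hqr H Y U V (fun _ => ε) (fun _ => 1) hH hY hU hV (fun _ _ => hε) (fun _ _ => one_pos)
      fun Q u hQ hu => by linarith [hfact Q u hQ hu]

/-- **ε-form ↔ strict form, LP slice** (for a fixed `δ`): "for every `c`, eventually, `rk₊(D - εJ) > m^c` for
every `ε > 0`" iff "for every `c`, eventually, the rows of `D` do not lie in the cone of `r ≤ m^c` functions
that are STRICTLY POSITIVE on the `⌈m^δ⌉₊`-sets" (`rk₊₊(D) > m^c`, Hrubeš's Lemma 16 (iii) form; this is his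
Open Problem 4 for the explicit matrix `D`, whose `rk₊` is `≤ #E`). [folklore; Hrubeš 2020 (`Hrubes2020`),
Lemma 16, Proposition 17] -/
theorem cliqueDist_rankHard_iff_strictRankHard (δ : ℝ) :
    (∀ c : ℕ, ∀ᶠ m : ℕ in Filter.atTop, ∀ ε : ℝ, 0 < ε → ∀ r : ℕ, r ≤ m ^ c →
      ∀ (U : ((⊤ : SimpleGraph (Fin m)).edgeSet → Bool) → Fin r → ℝ) (V : Fin r → Finset (Fin m) → ℝ),
        (∀ u l, 0 ≤ U u l) → (∀ l Q, 0 ≤ V l Q) →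
        ¬ ∀ (Q : Finset (Fin m)) (u : (⊤ : SimpleGraph (Fin m)).edgeSet → Bool), Q.card = ⌈(m : ℝ) ^ δ⌉₊ →
            cliqueFn m ⌈(m : ℝ) ^ δ⌉₊ u = false →
              (∑ e, if cliqueVec Q e = true ∧ u e = false then (1 : ℝ) else 0) - ε = ∑ l, U u l * V l Q) ↔
    (∀ c : ℕ, ∀ᶠ m : ℕ in Filter.atTop, ∀ r : ℕ, r ≤ m ^ c →
      ∀ (lam : ((⊤ : SimpleGraph (Fin m)).edgeSet → Bool) → Fin r → ℝ) (g : Fin r → Finset (Fin m) → ℝ),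
        (∀ u l, 0 ≤ lam u l) → (∀ l (Q : Finset (Fin m)), Q.card = ⌈(m : ℝ) ^ δ⌉₊ → 0 < g l Q) →
        ¬ ∀ (Q : Finset (Fin m)) (u : (⊤ : SimpleGraph (Fin m)).edgeSet → Bool), Q.card = ⌈(m : ℝ) ^ δ⌉₊ →
            cliqueFn m ⌈(m : ℝ) ^ δ⌉₊ u = false →
              (∑ e, if cliqueVec Q e = true ∧ u e = false then (1 : ℝ) else 0) = ∑ l, lam u l * g l Q) := by
  classical
  constructor
  · -- a strictly positive cone cover gives a factorisation of `D - εJ` with one more term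
    intro hε c
    filter_upwards [hε (c + 1), Filter.eventually_ge_atTop 2] with m hm hm2
    intro r hr lam g hlam hg hfact
    set k := ⌈(m : ℝ) ^ δ⌉₊ with hk
    set Su : Finset ((⊤ : SimpleGraph (Fin m)).edgeSet → Bool) := Finset.univ.filter fun u => cliqueFn m k u = false with hSu
    set SQ : Finset (Finset (Fin m)) := Finset.univ.filter fun Q => Q.card = k with hSQ
    have hbudget : r + 1 ≤ m ^ (c + 1) := by
      have h1 : 1 ≤ m ^ c := Nat.one_le_pow _ _ (by omega)
      have : m ^ c * 2 ≤ m ^ (c + 1) := by rw [pow_succ]; exact Nat.mul_le_mul_left _ hm2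
      omega
    by_cases hne : Su.Nonempty ∧ SQ.Nonempty
    · obtain ⟨hSune, ⟨Q₀, hQ₀⟩⟩ := hne
      have hQ₀k : Q₀.card = k := (Finset.mem_filter.1 hQ₀).2
      -- `r = 0` is impossible: `D ≥ 1`
      rcases Nat.eq_zero_or_pos r with hr0 | hrpos
      · subst hr0
        obtain ⟨u₀, hu₀⟩ := hSune
        have hu₀' : cliqueFn m k u₀ = false := (Finset.mem_filter.1 hu₀).2
        have h := hfact Q₀ u₀ hQ₀k hu₀'
        simp only [Finset.univ_eq_empty, Finset.sum_empty] at h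
        linarith [one_le_cliqueDist (m := m) hQ₀k hu₀']
      haveI : Nonempty (Fin r) := ⟨⟨0, hrpos⟩⟩
      -- `β = min g` over `k`-sets and generators, `s u = ∑ λ_l(u)`, `smin = min s` over clique-free `u`
      have hPne : (SQ ×ˢ (Finset.univ : Finset (Fin r))).Nonempty := ⟨⟨Q₀, ⟨0, hrpos⟩⟩, Finset.mem_product.2 ⟨hQ₀, Finset.mem_univ _⟩⟩
      set β := (SQ ×ˢ (Finset.univ : Finset (Fin r))).inf' hPne (fun p => g p.2 p.1) with hβ
      have hβ_pos : 0 < β := by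
        rw [hβ, Finset.lt_inf'_iff]
        rintro ⟨Q, l⟩ hp
        exact hg l Q (Finset.mem_filter.1 (Finset.mem_product.1 hp).1).2
      have hβ_le : ∀ l (Q : Finset (Fin m)), Q.card = k → β ≤ g l Q := fun l Q hQ => by
        have hmem : (Q, l) ∈ SQ ×ˢ (Finset.univ : Finset (Fin r)) :=
          Finset.mem_product.2 ⟨Finset.mem_filter.2 ⟨Finset.mem_univ _, hQ⟩, Finset.mem_univ _⟩
        exact Finset.inf'_le (fun p : Finset (Fin m) × Fin r => g p.2 p.1) hmem
      let s : ((⊤ : SimpleGraph (Fin m)).edgeSet → Bool) → ℝ := fun u => ∑ l, lam u l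
      have hs_pos : ∀ u, cliqueFn m k u = false → 0 < s u := by
        intro u hu
        by_contra hle
        rw [not_lt] at hle
        have hs0 : ∀ l, lam u l = 0 := by
          have hsum0 : ∑ l, lam u l = 0 := le_antisymm hle (Finset.sum_nonneg fun l _ => hlam u l)
          intro l
          exact (Finset.sum_eq_zero_iff_of_nonneg (fun l _ => hlam u l)).1 hsum0 l (Finset.mem_univ l)
        have h := hfact Q₀ u hQ₀k hu
        have h2 : ∑ l, lam u l * g l Q₀ = 0 := Finset.sum_eq_zero fun l _ => by rw [hs0 l, zero_mul]
        rw [h2] at h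
        linarith [one_le_cliqueDist (m := m) hQ₀k hu]
      set smin := Su.inf' hSune s with hsmin
      have hsmin_pos : 0 < smin := by
        rw [hsmin, Finset.lt_inf'_iff]
        intro u hu
        exact hs_pos u (Finset.mem_filter.1 hu).2
      have hsmin_le : ∀ u, cliqueFn m k u = false → smin ≤ s u := fun u hu => by
        have hmem : u ∈ Su := Finset.mem_filter.2 ⟨Finset.mem_univ _, hu⟩
        exact Finset.inf'_le s hmem
      let U' : ((⊤ : SimpleGraph (Fin m)).edgeSet → Bool) → Fin (r + 1) → ℝ := fun u =>
        Fin.cons (if cliqueFn m k u = false then β * (s u - smin) else 0) (lam u)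
      let V' : Fin (r + 1) → Finset (Fin m) → ℝ :=
        Fin.cons (fun _ => 1) (fun l Q => if Q.card = k then g l Q - β else 0)
      have hU' : ∀ u l, 0 ≤ U' u l := by
        intro u l
        refine Fin.cases ?_ (fun l => ?_) l
        · show 0 ≤ (if cliqueFn m k u = false then β * (s u - smin) else 0)
          split_ifs with hu
          · exact mul_nonneg hβ_pos.le (by linarith [hsmin_le u hu])
          · exact le_rfl
        · exact hlam u l
      have hV' : ∀ l Q, 0 ≤ V' l Q := by
        intro l Q
        refine Fin.cases ?_ (fun l => ?_) l
        · exact zero_le_one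
        · show 0 ≤ (if Q.card = k then g l Q - β else 0)
          split_ifs with hQ
          · linarith [hβ_le l Q hQ]
          · exact le_rfl
      refine hm (β * smin) (mul_pos hβ_pos hsmin_pos) (r + 1) hbudget U' V' hU' hV' fun Q u hQ hu => ?_
      have hsum : ∑ l, U' u l * V' l Q = β * (s u - smin) * 1 + ∑ l, lam u l * (g l Q - β) := by
        rw [Fin.sum_univ_succ]
        simp only [U', V', Fin.cons_zero, Fin.cons_succ, if_pos hQ, if_pos hu]
      have hsplit : ∑ l, lam u l * (g l Q - β) = ∑ l, lam u l * g l Q - β * s u := by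
        simp only [s, Finset.mul_sum, ← Finset.sum_sub_distrib]
        exact Finset.sum_congr rfl fun l _ => by ring
      rw [hsum, hsplit, hfact Q u hQ hu]
      ring
    · refine hm 1 one_pos r (by omega) lam (fun _ _ => 0) hlam (fun _ _ => le_rfl) fun Q u hQ hu => ?_
      exact absurd ⟨⟨u, Finset.mem_filter.2 ⟨Finset.mem_univ _, hu⟩⟩, ⟨Q, Finset.mem_filter.2 ⟨Finset.mem_univ _, hQ⟩⟩⟩ hne
  · -- a factorisation of `D - εJ` gives a strictly positive cone cover with one more generator
    intro hs c
    filter_upwards [hs (c + 1), Filter.eventually_ge_atTop 2] with m hm hm2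
    intro ε hε r hr U V hU hV hfact
    set k := ⌈(m : ℝ) ^ δ⌉₊ with hk
    have hbudget : r + 1 ≤ m ^ (c + 1) := by
      have h1 : 1 ≤ m ^ c := Nat.one_le_pow _ _ (by omega)
      have : m ^ c * 2 ≤ m ^ (c + 1) := by rw [pow_succ]; exact Nat.mul_le_mul_left _ hm2
      omega
    -- shift every generator by `θ = ε / (1 + T)`, `T = ∑_u ∑_l U_{u,l}`, and add the constant generator
    let s : ((⊤ : SimpleGraph (Fin m)).edgeSet → Bool) → ℝ := fun u => ∑ l, U u l
    set T : ℝ := ∑ u, s u with hT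
    have hs_nn : ∀ u, 0 ≤ s u := fun u => Finset.sum_nonneg fun l _ => hU u l
    have hT_nn : 0 ≤ T := Finset.sum_nonneg fun u _ => hs_nn u
    have hs_le : ∀ u, s u ≤ T := fun u =>
      Finset.single_le_sum (f := s) (fun u _ => hs_nn u) (Finset.mem_univ u)
    set θ : ℝ := ε / (1 + T) with hθ
    have hθ_pos : 0 < θ := div_pos hε (by linarith)
    have hcoef : ∀ u, 0 ≤ ε - θ * s u := by
      intro u
      have h1 : θ * s u ≤ θ * T := mul_le_mul_of_nonneg_left (hs_le u) hθ_pos.le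
      have h2 : θ * T ≤ ε := by
        rw [hθ, div_mul_eq_mul_div, div_le_iff₀ (by linarith)]
        nlinarith [hε.le, hT_nn]
      linarith
    let lam : ((⊤ : SimpleGraph (Fin m)).edgeSet → Bool) → Fin (r + 1) → ℝ := fun u =>
      Fin.cons (ε - θ * s u) (U u)
    let g : Fin (r + 1) → Finset (Fin m) → ℝ := Fin.cons (fun _ => 1) (fun l Q => V l Q + θ)
    have hlam : ∀ u l, 0 ≤ lam u l := by
      intro u l
      refine Fin.cases ?_ (fun l => ?_) l
      · exact hcoef u
      · exact hU u l
    have hg : ∀ l (Q : Finset (Fin m)), Q.card = k → 0 < g l Q := by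
      intro l Q _
      refine Fin.cases ?_ (fun l => ?_) l
      · exact one_pos
      · show 0 < V l Q + θ
        linarith [hV l Q]
    refine hm (r + 1) hbudget lam g hlam hg fun Q u hQ hu => ?_
    have hsum : ∑ l, lam u l * g l Q = (ε - θ * s u) * 1 + ∑ l, U u l * (V l Q + θ) := by
      rw [Fin.sum_univ_succ]
      simp only [lam, g, Fin.cons_zero, Fin.cons_succ]
    have hsplit : ∑ l, U u l * (V l Q + θ) = ∑ l, U u l * V l Q + θ * s u := by
      simp only [s, Finset.mul_sum, ← Finset.sum_add_distrib]
      exact Finset.sum_congr rfl fun l _ => by ring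
    rw [hsum, hsplit, ← hfact Q u hQ hu]
    ring

end Summit.PneNP.PneNP.Theorems
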